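import Summits.RiemannHypothesis.RiemannHypothesis.Theorems.WeilArchPanelsN109ENe109v1D
import HarnessLib

/-!
# G3 A-layer data: panel certificates — window vector `ne109v1` (`v(x) = P(x/b)`, b = 109/100, 40 panels)

Generated by `cert/abgen/panels.py` (prover A g12 cellgen; run by prover A g25 (A g24 kit) for the SHARP parity-ladder U-side (kernel scale 2^140, Kφ 64, 45-digit panel polynomials, exact per-panel budgets) at b = 109/100; dyadic penalty polynomial in `y = x/b`).
Kernel-checked by `decide +kernel`, each theorem a few seconds. [folklore]
-/

set_option linter.dupNamespace false

namespace Summit.RiemannHypothesis.RiemannHypothesis.Theorems.EvenWinsBeyondArch.ArchN109E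

open Literature.NumberTheory.LFunctions Literature.Analysis.ValidatedNumerics.PolyMP Literature.Analysis.ValidatedNumerics.NumericsMP Literature.Analysis.ValidatedNumerics.ExpPoly

set_option maxHeartbeats 0 in
/-- panel 20. [folklore] -/
theorem ne109v1_pc20 : archPanelCheck 1393796574908163946345982392040522594123776 (1 / 40) 22 14 64 5 20 4 20 (ne109v1Qs.getD 20 []) 1024 (ne109v1ps.getD 20 []) ne109v1E (((109 : ℚ)/100)) (ne109v1Ilo.getD 20 0) (ne109v1Ihi.getD 20 0) = true := by decide +kernel

set_option maxHeartbeats 0 in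
/-- panel 21. [folklore] -/
theorem ne109v1_pc21 : archPanelCheck 1393796574908163946345982392040522594123776 (1 / 40) 22 14 64 5 20 4 21 (ne109v1Qs.getD 21 []) 1024 (ne109v1ps.getD 21 []) ne109v1E (((109 : ℚ)/100)) (ne109v1Ilo.getD 21 0) (ne109v1Ihi.getD 21 0) = true := by decide +kernel

set_option maxHeartbeats 0 in
/-- panel 22. [folklore] -/
theorem ne109v1_pc22 : archPanelCheck 1393796574908163946345982392040522594123776 (1 / 40) 22 14 64 5 20 4 22 (ne109v1Qs.getD 22 []) 1024 (ne109v1ps.getD 22 []) ne109v1E (((109 : ℚ)/100)) (ne109v1Ilo.getD 22 0) (ne109v1Ihi.getD 22 0) = true := by decide +kernel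

set_option maxHeartbeats 0 in
/-- panel 23. [folklore] -/
theorem ne109v1_pc23 : archPanelCheck 1393796574908163946345982392040522594123776 (1 / 40) 22 14 64 5 20 4 23 (ne109v1Qs.getD 23 []) 1024 (ne109v1ps.getD 23 []) ne109v1E (((109 : ℚ)/100)) (ne109v1Ilo.getD 23 0) (ne109v1Ihi.getD 23 0) = true := by decide +kernel

set_option maxHeartbeats 0 in
/-- panel 24. [folklore] -/
theorem ne109v1_pc24 : archPanelCheck 1393796574908163946345982392040522594123776 (1 / 40) 22 14 64 5 20 4 24 (ne109v1Qs.getD 24 []) 1024 (ne109v1ps.getD 24 []) ne109v1E (((109 : ℚ)/100)) (ne109v1Ilo.getD 24 0) (ne109v1Ihi.getD 24 0) = true := by decide +kernel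

end Summit.RiemannHypothesis.RiemannHypothesis.Theorems.EvenWinsBeyondArch.ArchN109E
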